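import Summits.ABC.ABC.Theorems.CongruentialReceptacleTameLocalReceptacleCellLawsDefs

/-!
# Crux `CongruentialReceptacle.TameLocalReceptacle` (stmt-ABC-14354), line `grh-friable-cell-resolution`:
# objects + combinatorics of the explicit families

Objects + combinatorics of the explicit families of line `grh-friable-cell-resolution` (lead
`prover-line-stmt-ABC-14354-a1-0`, skeleton v5, 2026-08-17).  The interval-of-friables `friableIoc` and the three family
constructors `FAfam`, `FBfam`, `FCfam` of the checked skeleton
`Cruxes/TameLocalReceptacle/Lines/grh_friable_cell_resolution.lean` are declared here VERBATIM (CONVENTIONS §6: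
route-posited objects live in a reviewed Defs file, never in a proof file), together with the package of their
elementary clauses `FamilyCombinatorics` and its proof, the registered stub `stub_familyCombinatorics`:

* membership in `FAfam N M y` / `FCfam N M y` unpacked (`Finset.mem_image`, `mem_filter`, `mem_product`, `mem_Ioc`):
  `mem_FAfam`, `mem_FCfam`; `FBfam` is the swap image of `FAfam` (`mem_FBfam`);
* every member is a `1/4`-balanced abc-triple with the required 2-adic shape (`v₂(2^N m) = N` for `m` odd,
  `v₂(abc) = N` on `FAfam N` for `N ≥ 1`), of size `c ≤ 4 · 2^N M`, with `y`-friable members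
  (`a, b, c ∈ Nat.smoothNumbers (y+1)`, a set closed under products): `FAfam_spec`, `FBfam_spec`, `FCfam_spec`;
* two GENERIC facts over the Defs vocabulary: a family of triples with `y`-friable members has `FriableMembers y`
  (`friableMembers_of_smooth`), and a family of positive triples with `a + b = c` has `InadmissibleVanish`
  (`inadmissibleVanish_of_add`, from `adm_of_datum_eq`: at a prime `q` dividing the member in position `P`, the three
  residues of a key are unit residues of `q`-free parts, and `a + b = c` read mod `q` ties the two partners —
  `z = s` in position `A`, `z = r` in position `B`, `s = q − r` in position `C`).

Vocabulary: `IsBalanced`, `datum`, `mean` (`…TameLocalReceptacleDefs`); `Pos`, `Pos.sel/exps/adm`, `mkDatum`,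
`intensity` (`…KeyCellDefs`); `FriableMembers`, `InadmissibleVanish` (`…CellLawsDefs`).  Deliberately NOT here:
nonemptiness and the cell laws of these families (the analytic engine `stub_cellLawsAnalytic` of the skeleton).
-/

-- `Summit.<Summit>.<Problem>` is the mandated summit-side namespace (CONVENTIONS §2); for the
-- single-conjunct summit `ABC` the two coincide, so the duplicate `ABC.ABC` is deliberate.
set_option linter.dupNamespace false

noncomputable section

namespace Summit.ABC.ABC.Theorems.TameLocalReceptacle

open Finset Literature.NumberTheory.DiophantineGeometry

/-! ## The explicit families (verbatim from the registered skeleton v5) -/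

/-- The `y`-friable naturals in `(lo, hi]` (prime factors `≤ y`). -/
def friableIoc (y lo hi : ℕ) : Finset ℕ :=
  (Finset.Ioc lo hi).filter (fun n => n ∈ Nat.smoothNumbers (y + 1))

/-- FAMILY `FA(N, M, y) = {(2^N m, b, 2^N m + b)}`: `m` odd `y`-friable in `(M, 2M]`, `b` `y`-friable in `(X, 2X]`
(`X = 2^N M`), `gcd(b, 2m) = 1`, `c = 2^N m + b` `y`-friable.  With `N = 1` this is also the shape of the generic families:
`G = FA(1, 2^{N−1}M, y)` (scale `X`), `G' = FA(1, M, y)` (scale `X' = X/2^N`), boxes ALIGNED with `FA(N, M, y)`. -/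
def FAfam (N M y : ℕ) : Finset (ℕ × ℕ × ℕ) :=
  ((((friableIoc y M (2 * M)).filter (fun m => Odd m)) ×ˢ friableIoc y (2 ^ N * M) (2 * (2 ^ N * M))).filter
      (fun p => Nat.Coprime p.2 (2 * p.1) ∧ 2 ^ N * p.1 + p.2 ∈ Nat.smoothNumbers (y + 1))).image
    (fun p => (2 ^ N * p.1, p.2, 2 ^ N * p.1 + p.2))

/-- FAMILY `FB(N, M, y)`: the swap `(b, a, c)` of `FA(N, M, y)` (special member in position `B`). -/
def FBfam (N M y : ℕ) : Finset (ℕ × ℕ × ℕ) :=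
  (FAfam N M y).image (fun T => (T.2.1, T.1, T.2.2))

/-- FAMILY `FC(N, M, y) = {(a, 2^N m − a, 2^N m)}`: `m` odd `y`-friable in `(2M, 4M]` (so `c = 2^N m ∈ (2X, 4X]`),
`a` `y`-friable in `(X, 3X/2]`, `gcd(a, 2m) = 1`, `b = 2^N m − a` `y`-friable.  (The `ℕ`-subtraction never truncates:
`a ≤ 3X/2 ≤ 2X < 2^N m`, see `FCfam_spec`; `3X/2` is `3 * X / 2` in `ℕ`.) -/
def FCfam (N M y : ℕ) : Finset (ℕ × ℕ × ℕ) :=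
  ((((friableIoc y (2 * M) (4 * M)).filter (fun m => Odd m)) ×ˢ friableIoc y (2 ^ N * M) (3 * (2 ^ N * M) / 2)).filter
      (fun p => Nat.Coprime p.2 (2 * p.1) ∧ 2 ^ N * p.1 - p.2 ∈ Nat.smoothNumbers (y + 1))).image
    (fun p => (p.2, 2 ^ N * p.1 - p.2, 2 ^ N * p.1))

/-- **FAMILY COMBINATORICS** (registered stub `stub_familyCombinatorics`; everything elementary): for `N ≥ 1`, `M ≥ 1`,
`y ≥ 2` the three constructors consist of `1/4`-balanced abc-triples with the required 2-adic shapes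
(`v₂(a) = N` on `FA`, `v₂(b) = N` on `FB`, `v₂(c) = N` on `FC`, `v₂(abc) ≤ 1` on `FA(1, ·, y)`), sizes `c ≤ 4·2^N M`,
all prime factors `≤ y`, and vanishing intensity on inadmissible classes. -/
def FamilyCombinatorics : Prop :=
  ∀ N M y : ℕ, 1 ≤ N → 1 ≤ M → 2 ≤ y →
    (∀ T ∈ FAfam N M y, IsBalanced (1 / 4) T.1 T.2.1 T.2.2 ∧ T.1.factorization 2 = N) ∧
    (∀ T ∈ FBfam N M y, IsBalanced (1 / 4) T.1 T.2.1 T.2.2 ∧ T.2.1.factorization 2 = N) ∧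
    (∀ T ∈ FCfam N M y, IsBalanced (1 / 4) T.1 T.2.1 T.2.2 ∧ T.2.2.factorization 2 = N) ∧
    (∀ T ∈ FAfam 1 M y, (T.1 * T.2.1 * T.2.2).factorization 2 ≤ 1) ∧
    (∀ T ∈ FAfam N M y, T.2.2 ≤ 4 * (2 ^ N * M)) ∧ (∀ T ∈ FBfam N M y, T.2.2 ≤ 4 * (2 ^ N * M)) ∧
    (∀ T ∈ FCfam N M y, T.2.2 ≤ 4 * (2 ^ N * M)) ∧
    FriableMembers y (FAfam N M y) ∧ FriableMembers y (FBfam N M y) ∧ FriableMembers y (FCfam N M y) ∧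
    InadmissibleVanish (FAfam N M y) ∧ InadmissibleVanish (FBfam N M y) ∧ InadmissibleVanish (FCfam N M y)

/-! ## Generic facts: friable members and inadmissible classes -/

/-- A family whose three members are `(y+1)`-smooth has all prime factors of `abc` at most `y`. [folklore] -/
theorem friableMembers_of_smooth {y : ℕ} {F : Finset (ℕ × ℕ × ℕ)}
    (h : ∀ T ∈ F, T.1 ∈ Nat.smoothNumbers (y + 1) ∧ T.2.1 ∈ Nat.smoothNumbers (y + 1) ∧
      T.2.2 ∈ Nat.smoothNumbers (y + 1)) : FriableMembers y F := by
  intro T hT q hq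
  obtain ⟨ha, hb, hc⟩ := h T hT
  have habc := Nat.mul_mem_smoothNumbers (Nat.mul_mem_smoothNumbers ha hb) hc
  exact Nat.lt_succ_iff.1 (Nat.mem_smoothNumbers'.1 habc q (Nat.prime_of_mem_primeFactors hq)
    (Nat.dvd_of_mem_primeFactors hq))

/-- On a triple of positive integers with `a + b = c`, if the datum at a prime factor `q` of the member in position `P`
is a key `mkDatum (P.exps v) r s z` of that position, then its residues are ADMISSIBLE: all three are residues of
`q`-free parts, hence units, and `a + b = c` read mod `q` ties the two partners — `z = s` in position `A` (`q ∣ a`),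
`z = r` in position `B` (`q ∣ b`), `s = q − r` in position `C` (`q ∣ c`). [folklore] -/
theorem adm_of_datum_eq (P : Pos) {T : ℕ × ℕ × ℕ} (ha : 0 < T.1) (hb : 0 < T.2.1) (habc : T.1 + T.2.1 = T.2.2)
    {q v r s z : ℕ} (hq : q ∈ (P.sel T).primeFactors)
    (hD : datum T.1 T.2.1 T.2.2 q = mkDatum (P.exps v) r s z) : P.adm q r s z = true := by
  obtain ⟨a, b, c⟩ := T
  dsimp only at ha hb habc hD
  subst habc
  have hqp : q.Prime := Nat.prime_of_mem_primeFactors hq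
  -- the residue of a `q`-free part is a unit
  have hu : ∀ n : ℕ, 0 < n → 0 < n / q ^ n.factorization q % q := fun n hn =>
    Nat.pos_of_ne_zero fun h => Nat.not_dvd_ordCompl hqp hn.ne' (Nat.dvd_of_mod_eq_zero h)
  have hr0 := hu a ha
  have hs0 := hu b hb
  have hz0 := hu (a + b) (Nat.add_pos_left ha b)
  cases P with
  | A =>
    simp only [Pos.sel] at hq
    simp only [datum, mkDatum, Pos.exps, Prod.mk.injEq] at hD
    obtain ⟨-, hb0, hc0, hr, hs, hz⟩ := hD
    rw [hr] at hr0
    rw [hs] at hs0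
    rw [hb0, pow_zero, Nat.div_one] at hs
    rw [hc0, pow_zero, Nat.div_one] at hz
    obtain ⟨k, hk⟩ := Nat.dvd_of_mem_primeFactors hq
    have hzs : z = s := by rw [← hz, ← hs, hk, Nat.mul_add_mod]
    simp [Pos.adm, hr0, hs0, hzs]
  | B =>
    simp only [Pos.sel] at hq
    simp only [datum, mkDatum, Pos.exps, Prod.mk.injEq] at hD
    obtain ⟨ha0, -, hc0, hr, hs, hz⟩ := hD
    rw [hr] at hr0
    rw [hs] at hs0
    rw [ha0, pow_zero, Nat.div_one] at hr
    rw [hc0, pow_zero, Nat.div_one] at hz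
    obtain ⟨k, hk⟩ := Nat.dvd_of_mem_primeFactors hq
    have hzr : z = r := by rw [← hz, ← hr, hk, Nat.add_mul_mod_self_left]
    simp [Pos.adm, hr0, hs0, hzr]
  | C =>
    simp only [Pos.sel] at hq
    simp only [datum, mkDatum, Pos.exps, Prod.mk.injEq] at hD
    obtain ⟨ha0, hb0, -, hr, hs, hz⟩ := hD
    rw [hr] at hr0
    rw [hz] at hz0
    rw [ha0, pow_zero, Nat.div_one] at hr
    rw [hb0, pow_zero, Nat.div_one] at hs
    have hsr : s = q - r := by
      have h := Nat.mod_eq_zero_of_dvd (Nat.dvd_of_mem_primeFactors hq)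
      rw [Nat.add_mod_eq_ite, hr, hs] at h
      split_ifs at h <;> omega
    simp [Pos.adm, hr0, hz0, hsr]

/-- **Families of positive triples with `a + b = c` carry no key in an inadmissible class**: every indicator in the
mean defining `intensity F P q (mkDatum (P.exps v) r s z)` vanishes by `adm_of_datum_eq`. [folklore] -/
theorem inadmissibleVanish_of_add {F : Finset (ℕ × ℕ × ℕ)}
    (hF : ∀ T ∈ F, 0 < T.1 ∧ 0 < T.2.1 ∧ T.1 + T.2.1 = T.2.2) : InadmissibleVanish F := by
  intro P q v r s z _ _ _ hadm
  unfold intensity mean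
  rw [Finset.sum_eq_zero fun T hT => ?_, zero_div]
  obtain ⟨ha, hb, habc⟩ := hF T hT
  rw [if_neg]
  rintro ⟨hq, hD⟩
  have h := adm_of_datum_eq P ha hb habc hq hD
  rw [hadm] at h
  exact Bool.false_ne_true h

/-- The same for families of abc-triples. [folklore] -/
theorem inadmissibleVanish_of_abc {F : Finset (ℕ × ℕ × ℕ)} (hF : ∀ T ∈ F, IsABCTriple T.1 T.2.1 T.2.2) :
    InadmissibleVanish F :=
  inadmissibleVanish_of_add fun T hT => ⟨(hF T hT).1, (hF T hT).2.1, (hF T hT).2.2.1⟩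

/-! ## Small arithmetic helpers -/

/-- `2^N` is `y`-friable for `y ≥ 2`. [folklore] -/
theorem two_pow_mem_smoothNumbers (N : ℕ) {y : ℕ} (hy : 2 ≤ y) : 2 ^ N ∈ Nat.smoothNumbers (y + 1) :=
  Nat.mem_smoothNumbers'.2 fun _ hp hdvd =>
    Nat.lt_succ_of_le ((Nat.le_of_dvd two_pos (hp.dvd_of_dvd_pow hdvd)).trans hy)

/-- `v₂(2^N m) = N` for `m` odd. [folklore] -/
theorem factorization_two_pow_mul_odd (N : ℕ) {m : ℕ} (hm : Odd m) : (2 ^ N * m).factorization 2 = N := by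
  rw [Nat.factorization_mul (pow_ne_zero N two_ne_zero) hm.pos.ne', Finsupp.add_apply,
    Nat.factorization_pow_self Nat.prime_two, Nat.factorization_eq_zero_of_not_dvd hm.not_two_dvd_nat, add_zero]

/-- The balance inequality at `κ = 1/4` from the integer inequality `c ≤ 4a`. [folklore] -/
theorem quarter_mul_le {a c : ℕ} (h : c ≤ 4 * a) : (1 / 4 : ℝ) * (c : ℝ) ≤ (a : ℝ) := by
  have h' : (c : ℝ) ≤ 4 * (a : ℝ) := by exact_mod_cast h
  linarith

/-! ## The family `FA` -/

/-- Membership in `FAfam N M y` unpacked. [folklore] -/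
theorem mem_FAfam {N M y : ℕ} {T : ℕ × ℕ × ℕ} (h : T ∈ FAfam N M y) :
    ∃ m b : ℕ, M < m ∧ m ≤ 2 * M ∧ m ∈ Nat.smoothNumbers (y + 1) ∧ Odd m ∧
      2 ^ N * M < b ∧ b ≤ 2 * (2 ^ N * M) ∧ b ∈ Nat.smoothNumbers (y + 1) ∧
      Nat.Coprime b (2 * m) ∧ 2 ^ N * m + b ∈ Nat.smoothNumbers (y + 1) ∧
      T = (2 ^ N * m, b, 2 ^ N * m + b) := by
  simp only [FAfam, friableIoc, Finset.mem_image, Finset.mem_filter, Finset.mem_product, Finset.mem_Ioc,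
    Prod.exists, and_assoc] at h
  obtain ⟨m, b, h1, h2, h3, h4, h5, h6, h7, h8, h9, rfl⟩ := h
  exact ⟨m, b, h1, h2, h3, h4, h5, h6, h7, h8, h9, rfl⟩

/-- The clauses of a member `(2^N m, b, 2^N m + b)` of `FAfam N M y` (`y ≥ 2`): a `1/4`-balanced abc-triple
(`X < a ≤ 2X`, `X < b ≤ 2X`, so `c ≤ 4X < 4 min(a, b)`; `gcd(2^N m, b) = 1` from `gcd(b, 2m) = 1`), `v₂(a) = N`,
`v₂(abc) = N` when `N ≥ 1` (`b` and `c` odd), `c ≤ 4X`, and `a, b, c` `y`-friable. [folklore] -/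
theorem FAfam_spec {N M y : ℕ} (hy : 2 ≤ y) {T : ℕ × ℕ × ℕ} (h : T ∈ FAfam N M y) :
    IsBalanced (1 / 4) T.1 T.2.1 T.2.2 ∧ T.1.factorization 2 = N ∧
      (1 ≤ N → (T.1 * T.2.1 * T.2.2).factorization 2 = N) ∧ T.2.2 ≤ 4 * (2 ^ N * M) ∧
      T.1 ∈ Nat.smoothNumbers (y + 1) ∧ T.2.1 ∈ Nat.smoothNumbers (y + 1) ∧
      T.2.2 ∈ Nat.smoothNumbers (y + 1) := by
  obtain ⟨m, b, hMm, hm2, hms, hmo, hXb, hb2, hbs, hcop, hcs, rfl⟩ := mem_FAfam h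
  dsimp only
  obtain ⟨hb2', hbm⟩ := Nat.coprime_mul_iff_right.1 hcop
  have hbo : Odd b := Nat.coprime_two_right.1 hb2'
  have h1 : 2 ^ N * M < 2 ^ N * m := Nat.mul_lt_mul_of_pos_left hMm (Nat.two_pow_pos N)
  have h2 : 2 ^ N * m ≤ 2 * (2 ^ N * M) :=
    calc 2 ^ N * m ≤ 2 ^ N * (2 * M) := Nat.mul_le_mul_left _ hm2
      _ = 2 * (2 ^ N * M) := by ring
  have habc : IsABCTriple (2 ^ N * m) b (2 ^ N * m + b) :=
    ⟨by omega, by omega, rfl, Nat.Coprime.mul_left (Nat.Coprime.pow_left N hb2'.symm) hbm.symm⟩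
  have hva : (2 ^ N * m).factorization 2 = N := factorization_two_pow_mul_odd N hmo
  have has : 2 ^ N * m ∈ Nat.smoothNumbers (y + 1) :=
    Nat.mul_mem_smoothNumbers (two_pow_mem_smoothNumbers N hy) hms
  refine ⟨⟨habc, quarter_mul_le (by omega), quarter_mul_le (by omega)⟩, hva, fun hN => ?_, by omega, has, hbs, hcs⟩
  have hco : Odd (2 ^ N * m + b) :=
    Even.add_odd (even_iff_two_dvd.2 (dvd_mul_of_dvd_left (dvd_pow_self 2 (by omega)) m)) hbo
  rw [Nat.factorization_mul (Nat.mul_ne_zero (by omega) (by omega)) (by omega),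
    Nat.factorization_mul (by omega) (by omega), Finsupp.add_apply, Finsupp.add_apply, hva,
    Nat.factorization_eq_zero_of_not_dvd hbo.not_two_dvd_nat,
    Nat.factorization_eq_zero_of_not_dvd hco.not_two_dvd_nat, add_zero, add_zero]

/-! ## The family `FC` -/

/-- Membership in `FCfam N M y` unpacked. [folklore] -/
theorem mem_FCfam {N M y : ℕ} {T : ℕ × ℕ × ℕ} (h : T ∈ FCfam N M y) :
    ∃ m a : ℕ, 2 * M < m ∧ m ≤ 4 * M ∧ m ∈ Nat.smoothNumbers (y + 1) ∧ Odd m ∧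
      2 ^ N * M < a ∧ a ≤ 3 * (2 ^ N * M) / 2 ∧ a ∈ Nat.smoothNumbers (y + 1) ∧
      Nat.Coprime a (2 * m) ∧ 2 ^ N * m - a ∈ Nat.smoothNumbers (y + 1) ∧
      T = (a, 2 ^ N * m - a, 2 ^ N * m) := by
  simp only [FCfam, friableIoc, Finset.mem_image, Finset.mem_filter, Finset.mem_product, Finset.mem_Ioc,
    Prod.exists, and_assoc] at h
  obtain ⟨m, a, h1, h2, h3, h4, h5, h6, h7, h8, h9, rfl⟩ := h
  exact ⟨m, a, h1, h2, h3, h4, h5, h6, h7, h8, h9, rfl⟩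

/-- The clauses of a member `(a, 2^N m − a, 2^N m)` of `FCfam N M y` (`y ≥ 2`): a `1/4`-balanced abc-triple
(`2X < c ≤ 4X`, `X < a ≤ 3X/2`, so `a < c`, `c < 4a` and `4b = 4c − 4a ≥ 4c − 6X > c`; `gcd(a, c − a) = gcd(a, c) = 1`
from `gcd(a, 2m) = 1`), `v₂(c) = N`, `c ≤ 4X`, and `a, b, c` `y`-friable. [folklore] -/
theorem FCfam_spec {N M y : ℕ} (hy : 2 ≤ y) {T : ℕ × ℕ × ℕ} (h : T ∈ FCfam N M y) :
    IsBalanced (1 / 4) T.1 T.2.1 T.2.2 ∧ T.2.2.factorization 2 = N ∧ T.2.2 ≤ 4 * (2 ^ N * M) ∧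
      T.1 ∈ Nat.smoothNumbers (y + 1) ∧ T.2.1 ∈ Nat.smoothNumbers (y + 1) ∧
      T.2.2 ∈ Nat.smoothNumbers (y + 1) := by
  obtain ⟨m, a, hMm, hm4, hms, hmo, hXa, ha3, has, hcop, hbs, rfl⟩ := mem_FCfam h
  dsimp only
  obtain ⟨ha2, ham⟩ := Nat.coprime_mul_iff_right.1 hcop
  have h1 : 2 * (2 ^ N * M) < 2 ^ N * m :=
    calc 2 * (2 ^ N * M) = 2 ^ N * (2 * M) := by ring
      _ < 2 ^ N * m := Nat.mul_lt_mul_of_pos_left hMm (Nat.two_pow_pos N)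
  have h2 : 2 ^ N * m ≤ 4 * (2 ^ N * M) :=
    calc 2 ^ N * m ≤ 2 ^ N * (4 * M) := Nat.mul_le_mul_left _ hm4
      _ = 4 * (2 ^ N * M) := by ring
  have habc : IsABCTriple a (2 ^ N * m - a) (2 ^ N * m) :=
    ⟨by omega, by omega, by omega,
      (Nat.coprime_sub_self_right (by omega)).2 (Nat.Coprime.mul_right (Nat.Coprime.pow_right N ha2) ham)⟩
  exact ⟨⟨habc, quarter_mul_le (by omega), quarter_mul_le (by omega)⟩, factorization_two_pow_mul_odd N hmo, h2,
    has, hbs, Nat.mul_mem_smoothNumbers (two_pow_mem_smoothNumbers N hy) hms⟩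

/-! ## The family `FB` and the registered stub -/

/-- Membership in `FBfam N M y`: the swap of a member of `FAfam N M y`. [folklore] -/
theorem mem_FBfam {N M y : ℕ} {T : ℕ × ℕ × ℕ} (h : T ∈ FBfam N M y) :
    ∃ T' ∈ FAfam N M y, T = (T'.2.1, T'.1, T'.2.2) := by
  obtain ⟨T', hT', rfl⟩ := Finset.mem_image.1 h
  exact ⟨T', hT', rfl⟩

/-- The clauses of a member `(b, a, c)` of `FBfam N M y` (`y ≥ 2`), transferred from `FAfam_spec`. [folklore] -/
theorem FBfam_spec {N M y : ℕ} (hy : 2 ≤ y) {T : ℕ × ℕ × ℕ} (h : T ∈ FBfam N M y) :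
    IsBalanced (1 / 4) T.1 T.2.1 T.2.2 ∧ T.2.1.factorization 2 = N ∧ T.2.2 ≤ 4 * (2 ^ N * M) ∧
      T.1 ∈ Nat.smoothNumbers (y + 1) ∧ T.2.1 ∈ Nat.smoothNumbers (y + 1) ∧
      T.2.2 ∈ Nat.smoothNumbers (y + 1) := by
  obtain ⟨T', hT', rfl⟩ := mem_FBfam h
  dsimp only
  obtain ⟨⟨⟨ha, hb, habc, hcop⟩, hca, hcb⟩, hva, -, hc4, has, hbs, hcs⟩ := FAfam_spec hy hT'
  exact ⟨⟨⟨hb, ha, by rw [add_comm]; exact habc, hcop.symm⟩, hcb, hca⟩, hva, hc4, hbs, has, hcs⟩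

/-- **Registered stub `stub_familyCombinatorics`** (line `grh-friable-cell-resolution` of crux stmt-ABC-14354; stub 4e
of the checked skeleton): `FamilyCombinatorics` for the explicit constructors `FAfam`, `FBfam`, `FCfam` — assembled
from `FAfam_spec` (at `N` and at `N = 1`), `FBfam_spec`, `FCfam_spec`, `friableMembers_of_smooth` and
`inadmissibleVanish_of_abc`.  (The hypotheses `1 ≤ N`, `1 ≤ M` of `FamilyCombinatorics` are not needed for these clauses;
`y ≥ 2` is used only for the friability of the factor `2^N`.) [folklore] -/
theorem stub_familyCombinatorics : FamilyCombinatorics := by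
  intro N M y _ _ hy
  have hA := fun T (hT : T ∈ FAfam N M y) => FAfam_spec hy hT
  have hB := fun T (hT : T ∈ FBfam N M y) => FBfam_spec hy hT
  have hC := fun T (hT : T ∈ FCfam N M y) => FCfam_spec hy hT
  have hG := fun T (hT : T ∈ FAfam 1 M y) => FAfam_spec hy hT
  refine ⟨fun T hT => ⟨(hA T hT).1, (hA T hT).2.1⟩, fun T hT => ⟨(hB T hT).1, (hB T hT).2.1⟩,
    fun T hT => ⟨(hC T hT).1, (hC T hT).2.1⟩, fun T hT => ((hG T hT).2.2.1 le_rfl).le,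
    fun T hT => (hA T hT).2.2.2.1, fun T hT => (hB T hT).2.2.1, fun T hT => (hC T hT).2.2.1,
    friableMembers_of_smooth fun T hT => (hA T hT).2.2.2.2,
    friableMembers_of_smooth fun T hT => (hB T hT).2.2.2,
    friableMembers_of_smooth fun T hT => (hC T hT).2.2.2,
    inadmissibleVanish_of_abc fun T hT => (hA T hT).1.1,
    inadmissibleVanish_of_abc fun T hT => (hB T hT).1.1,
    inadmissibleVanish_of_abc fun T hT => (hC T hT).1.1⟩

end Summit.ABC.ABC.Theorems.TameLocalReceptacle

end
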